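import Literature.NumberTheory.GaloisRepresentations.LubinTateComparisonDerivation
import Literature.NumberTheory.GaloisRepresentations.LubinTateInvariantDifferential
import HarnessLib

/-!
# The invariant derivation in the logarithmic coordinate: `λ′ · ω = 1`, `D^k (G ∘ λ) = G^{(k)} ∘ λ`, and
# `[X⁰] D^k h = k! · [z^k] (h ∘ e)` — the Lubin–Tate-side moments are Taylor coefficients in `z = λ(X)`

Topic `NumberTheory/GaloisRepresentations`; namespace `Literature.NumberTheory.GaloisRepresentations.LubinTate`
(sequel of `LubinTateComparisonDerivation.lean` — derivations to all orders under a pullback identity — and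
`LubinTateComparisonDifferential.lean` — `twisted_rigidity`; instantiated on the tree's `ltLog` / `invDiff` in
`LubinTateLogarithmDifferential.lean`).

De Shalit, *Iwasawa theory of elliptic curves with complex multiplication* (1987), I §3.5 (p. 18):
"Let `D = (Ω/λ′(T)) d/dT` be the translation invariant derivation of `F_f`"; II §4.9 (p. 62–63):
"`Q(T) = P(λ_Ê(T))` […] since the formal group law in the `z` variable is the additive law, `z` is […]
the normalized logarithm of `t`. Thus `Q(T)` is nothing but the expansion […] in terms of `t`";
II §4.10 (p. 64) line 2: `((Ω_p/λ′(t)) d/dt)^k log g_{e(𝔞)}(t)|_{t=0} = Ω_p^k · (d/dz)^k log Θ(Ω − z; L, 𝔞)|_{z=0}`.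
The formal content, proved here (0 sorry, no definitions):

* §1 (any commutative ring `A`; `λ(0) = 0`, `λ′ · ϖ = 1`): `derivation_subst_log` **`ϖ · (G ∘ λ)′ = G′ ∘ λ`**,
  `iterate_derivation_subst_log` **`(ϖ·d/dX)^[k] (G ∘ λ) = (d/dX)^[k] G ∘ λ`** (the invariant derivation IS
  `d/dz` in the coordinate `z = λ(X)`), `constantCoeff_iterate_derivative` `[X⁰] (d/dX)^[k] G = k!·[X^k] G`,
  and, when `λ′(0)` is a unit (so `e = λ⁻¹` exists, Mathlib `substInvOfIsUnit`),
  ★★ `constantCoeff_iterate_derivation_eq_factorial_mul_coeff_subst_substInv`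
  **`[X⁰] (ϖ·d/dX)^[k] h = k! · [z^k] (h ∘ e)`** for EVERY `h` — the `k`-th invariant derivative at the origin
  is the `k`-th Taylor coefficient in the logarithmic coordinate; `derivative_substInv_eq_subst` (`e′ = ϖ ∘ e`),
  ★ `dlog_map_substAlgHom_substInv` (`dlog (G ∘ e) = (ϖ·dlog G) ∘ e`: Coleman's `δG = ϖ G′/G` is the plain
  logarithmic derivative in the coordinate `z`) and ★★ `…_invLogDeriv_eq_factorial_mul_coeff_dlog`
  **`[X⁰] (ϖ·d/dX)^[k] (ϖ · dlog G) = k! · [z^k] dlog (G ∘ e)`** (`φ_{k+1} = (d/dz)^{k+1} log (G ∘ e)(0)`);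
* §2 (generic) ★ `derivative_log_mul_invDiff_eq_one` — **`λ′ · ω = 1`** for ANY pair of series with the two
  functional equations `λ ∘ f = C π · λ` (`λ ≡ X`) and `ω · f′ = C π · ω ∘ f` (`ω(0) = 1`), `f ≡ πX`, over a
  ring where `π` is regular and `1 − πⁿ` are units (`n ≥ 1`): the docstring identity "`ω_F = 1/λ_f′`" of
  `LubinTate.invDiff`, PROVED (`λ′ω` is fixed under `X ↦ f(X)`, hence constant, by `twisted_rigidity` with
  `φ = id`).  The instantiation on the tree's `ltLog` / `invDiff` of `f = πX + X^q` over the local field `F`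
  is the sequel `LubinTateLogarithmDifferential.lean`; with it the Coates–Wiles value
  `φ^{CW}_{k+1}(g) = [X⁰] D^k δg` (`LubinTateCoatesWilesHom`) is `k!` times the `k`-th Taylor coefficient of
  `δg ∘ e_f`, i.e. `(d/dz)^{k+1} log (g ∘ e_f)(0)` — what de Shalit II §4.9–4.10 identifies, for the elliptic
  units, with `(d/dz)^{k+1} log Θ(Ω − z; L, 𝔞)|_{z=0} = −12·E_{k+1}(Ω; L, 𝔞)`.

Cell `bsd-print-cf2`, width seat `bsd-line-cf2c-w4` g11 (measure lane of de Shalit II.4 at `p = 2`, brick B6).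

## References

* [deShalit1987] E. de Shalit, *Iwasawa theory of elliptic curves with complex multiplication*,
  Perspectives in Math. 3 (1987), Ch. I §1.2, §3.5 (p. 18), II §4.9 (p. 62–63), II §4.10 (p. 64).
* [LubinTate1965] J. Lubin, J. Tate, *Formal complex multiplication in local fields*, Ann. of Math. 81
  (1965), §1 Lemma 1.
* [Lang1990] S. Lang, *Cyclotomic Fields I and II*, GTM 121 (1990), Ch. 8 §6 (the logarithm).
-/

noncomputable section

open PowerSeries

namespace Literature.NumberTheory.GaloisRepresentations

namespace LubinTate

variable {A : Type*} [CommRing A]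

/-! ### Helpers -/

/-- `G(f)(0) = G(0)` when `f(0) = 0`. [folklore] -/
private theorem constantCoeff_subst_of_constantCoeff_eq_zero {f : A⟦X⟧} (hf : constantCoeff f = 0)
    (G : A⟦X⟧) : constantCoeff (G.subst f) = constantCoeff G := by
  have hs : HasSubst f := HasSubst.of_constantCoeff_zero' hf
  have h := PowerSeries.constantCoeff_subst hs G
  rw [finsum_eq_single _ 0 (fun d hd => by
    rw [map_pow, show MvPowerSeries.constantCoeff f = constantCoeff f from rfl, hf, zero_pow hd,
      smul_zero])] at h
  rw [pow_zero, map_one, coeff_zero_eq_constantCoeff, smul_eq_mul, mul_one] at h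
  exact h

/-- `(d⁄dX G)(0) = G₁`. [folklore] -/
private theorem constantCoeff_derivative' (G : A⟦X⟧) : constantCoeff (d⁄dX A G) = coeff 1 G := by
  rw [← coeff_zero_eq_constantCoeff_apply, coeff_derivative, Nat.cast_zero, zero_add, zero_add, mul_one]

/-- `subst` is multiplicative (spelling without `substAlgHom`). [folklore] -/
private theorem subst_mul' {a : A⟦X⟧} (ha : HasSubst a) (G H : A⟦X⟧) :
    (G * H).subst a = G.subst a * H.subst a := by
  rw [← coe_substAlgHom ha, map_mul]

/-- Cancel a power of a non-zero-divisor. [folklore] -/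
private theorem eq_zero_of_pow_mul_eq_zero_of_regular' {π : A} (hreg : ∀ x : A, π * x = 0 → x = 0) (m : ℕ)
    {x : A} (h : π ^ m * x = 0) : x = 0 := by
  induction m generalizing x with
  | zero => simpa using h
  | succ m ih =>
    rw [pow_succ, mul_assoc] at h
    exact hreg _ (ih h)

/-! ### §1 The derivation `ϖ · d/dX` in the coordinate `z = λ(X)` when `λ′ · ϖ = 1` -/

section LogCoordinate

variable {lam ϖ : A⟦X⟧}

/-- ★ **`ϖ · (G ∘ λ)′ = G′ ∘ λ`** when `λ′ · ϖ = 1` (chain rule): the derivation `ϖ · d/dX` is `d/dz` in the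
coordinate `z = λ`. [cite: deShalit1987, Ch. I §3.5 (p. 18), II §4.9 (p. 63)] -/
theorem derivation_subst_log (hlam0 : constantCoeff lam = 0) (hω : d⁄dX A lam * ϖ = 1) (G : A⟦X⟧) :
    ϖ * d⁄dX A (G.subst lam) = (d⁄dX A G).subst lam := by
  have hs : HasSubst lam := HasSubst.of_constantCoeff_zero' hlam0
  rw [derivative_subst A hs, show ϖ * ((d⁄dX A G).subst lam * d⁄dX A lam) =
    (d⁄dX A G).subst lam * (d⁄dX A lam * ϖ) by ring, hω, mul_one]

/-- ★ **`(ϖ · d/dX)^[k] (G ∘ λ) = ((d/dX)^[k] G) ∘ λ`** when `λ′ · ϖ = 1`.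
[cite: deShalit1987, Ch. I §3.5 (p. 18), II §4.10 (p. 64)] -/
theorem iterate_derivation_subst_log (hlam0 : constantCoeff lam = 0) (hω : d⁄dX A lam * ϖ = 1) (k : ℕ)
    (G : A⟦X⟧) :
    (fun g : A⟦X⟧ => ϖ * d⁄dX A g)^[k] (G.subst lam) = ((⇑(d⁄dX A))^[k] G).subst lam := by
  induction k generalizing G with
  | zero => rfl
  | succ k ih =>
    rw [Function.iterate_succ_apply, Function.iterate_succ_apply, derivation_subst_log hlam0 hω, ih]

/-- **`[X⁰] (d/dX)^[k] G = k! · [X^k] G`** (Taylor coefficients). [cite: deShalit1987, II §4.9 (p. 62)] -/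
theorem constantCoeff_iterate_derivative (k : ℕ) (G : A⟦X⟧) :
    constantCoeff ((⇑(d⁄dX A))^[k] G) = (k.factorial : A) * coeff k G := by
  induction k generalizing G with
  | zero => rw [Function.iterate_zero_apply, Nat.factorial_zero, Nat.cast_one, one_mul,
      coeff_zero_eq_constantCoeff_apply]
  | succ k ih =>
    rw [Function.iterate_succ_apply, ih, coeff_derivative, Nat.factorial_succ, Nat.cast_mul, Nat.cast_succ]
    ring

/-- ★ **`[X⁰] (ϖ · d/dX)^[k] (G ∘ λ) = k! · [z^k] G`** when `λ′ · ϖ = 1`, `λ(0) = 0`.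
[cite: deShalit1987, II §4.10 (p. 64)] -/
theorem constantCoeff_iterate_derivation_subst_log (hlam0 : constantCoeff lam = 0)
    (hω : d⁄dX A lam * ϖ = 1) (k : ℕ) (G : A⟦X⟧) :
    constantCoeff ((fun g : A⟦X⟧ => ϖ * d⁄dX A g)^[k] (G.subst lam)) = (k.factorial : A) * coeff k G := by
  rw [iterate_derivation_subst_log hlam0 hω, constantCoeff_subst_of_constantCoeff_eq_zero hlam0,
    constantCoeff_iterate_derivative]

/-- ★★ **The invariant derivatives at the origin are Taylor coefficients in the logarithmic coordinate**:
`[X⁰] (ϖ · d/dX)^[k] h = k! · [z^k] (h ∘ e)` for EVERY `h`, where `e = λ⁻¹` is the compositional inverse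
(the "exponential"; Mathlib `substInvOfIsUnit`, `λ′(0)` a unit) and `λ′ · ϖ = 1`.
[cite: deShalit1987, II §4.9 (p. 62–63), II §4.10 (p. 64)] -/
theorem constantCoeff_iterate_derivation_eq_factorial_mul_coeff_subst_substInv (hlam0 : constantCoeff lam = 0)
    (hlam1 : IsUnit (coeff 1 lam)) (hω : d⁄dX A lam * ϖ = 1) (k : ℕ) (h : A⟦X⟧) :
    constantCoeff ((fun g : A⟦X⟧ => ϖ * d⁄dX A g)^[k] h) =
      (k.factorial : A) * coeff k (h.subst (lam.substInvOfIsUnit hlam1)) := by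
  have hs : HasSubst lam := HasSubst.of_constantCoeff_zero' hlam0
  have hsi : PowerSeries.HasSubst (lam.substInvOfIsUnit hlam1) :=
    PowerSeries.HasSubst.of_constantCoeff_zero' (PowerSeries.constantCoeff_substInvOfIsUnit lam hlam1)
  have hG : PowerSeries.subst lam (PowerSeries.subst (lam.substInvOfIsUnit hlam1) h) = h := by
    rw [PowerSeries.subst_comp_subst_apply hsi hs, PowerSeries.subst_substInvOfIsUnit_left lam hlam0 hlam1,
      PowerSeries.X_subst]
  conv_lhs => rw [← hG]
  exact constantCoeff_iterate_derivation_subst_log hlam0 hω k _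

/-- **The derivative of the exponential**: `e′ = ϖ ∘ e` for `e = λ⁻¹` when `λ′ · ϖ = 1` (differentiate
`λ(e(z)) = z`). [cite: deShalit1987, II §4.9 (p. 63)] -/
theorem derivative_substInv_eq_subst (hlam0 : constantCoeff lam = 0) (hlam1 : IsUnit (coeff 1 lam))
    (hω : d⁄dX A lam * ϖ = 1) :
    d⁄dX A (lam.substInvOfIsUnit hlam1) = ϖ.subst (lam.substInvOfIsUnit hlam1) := by
  have hse : PowerSeries.HasSubst (lam.substInvOfIsUnit hlam1) :=
    PowerSeries.HasSubst.of_constantCoeff_zero' (PowerSeries.constantCoeff_substInvOfIsUnit lam hlam1)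
  have h1 : (d⁄dX A lam).subst (lam.substInvOfIsUnit hlam1) * d⁄dX A (lam.substInvOfIsUnit hlam1) = 1 := by
    rw [← derivative_subst A hse, PowerSeries.subst_substInvOfIsUnit_right lam hlam0 hlam1, derivative_X]
  have h2 : (d⁄dX A lam).subst (lam.substInvOfIsUnit hlam1) * ϖ.subst (lam.substInvOfIsUnit hlam1) = 1 := by
    rw [← subst_mul' hse, hω, ← coe_substAlgHom hse, map_one]
  linear_combination ϖ.subst (lam.substInvOfIsUnit hlam1) * h1 -
    d⁄dX A (lam.substInvOfIsUnit hlam1) * h2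

/-- ★ **`dlog (G ∘ e) = (ϖ · dlog G) ∘ e`**: in the logarithmic coordinate the invariant logarithmic
derivative `ϖ · G′/G` (Coleman's `δG`, de Shalit's `D log G`) is the plain logarithmic derivative of `G ∘ e`.
[cite: deShalit1987, Ch. I §3.5 (p. 18), II §4.10 (p. 64)] -/
theorem dlog_map_substAlgHom_substInv (hlam0 : constantCoeff lam = 0) (hlam1 : IsUnit (coeff 1 lam))
    (hω : d⁄dX A lam * ϖ = 1) (G : (A⟦X⟧)ˣ) :
    PowerSeries.dlog (Units.map (substAlgHom (PowerSeries.HasSubst.of_constantCoeff_zero'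
        (PowerSeries.constantCoeff_substInvOfIsUnit lam hlam1)) : A⟦X⟧ →ₐ[A] A⟦X⟧).toMonoidHom G) =
      (ϖ * PowerSeries.dlog G).subst (lam.substInvOfIsUnit hlam1) := by
  have hse : PowerSeries.HasSubst (lam.substInvOfIsUnit hlam1) :=
    PowerSeries.HasSubst.of_constantCoeff_zero' (PowerSeries.constantCoeff_substInvOfIsUnit lam hlam1)
  rw [PowerSeries.dlog_eq_of_subst_eq hse G _
      (by rw [Units.coe_map]; change substAlgHom _ (G : A⟦X⟧) = _; rw [coe_substAlgHom]),
    derivative_substInv_eq_subst hlam0 hlam1 hω, subst_mul' hse]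
  ring

/-- ★★ **The Coates–Wiles-type values `[X⁰] (ϖ·d/dX)^[k] (ϖ · dlog G)` are the Taylor coefficients of the
logarithmic derivative in the logarithmic coordinate**: `= k! · [z^k] dlog (G ∘ e)` (so de Shalit's
`φ_{k+1}(β) = D^{k+1} log g_β (0)` is `(d/dz)^{k+1} log (g_β ∘ e)(0)`).
[cite: deShalit1987, Ch. I §3.5 (11) (p. 18), II §4.10 (p. 64)] -/
theorem constantCoeff_iterate_derivation_invLogDeriv_eq_factorial_mul_coeff_dlog (hlam0 : constantCoeff lam = 0)
    (hlam1 : IsUnit (coeff 1 lam)) (hω : d⁄dX A lam * ϖ = 1) (k : ℕ) (G : (A⟦X⟧)ˣ) :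
    constantCoeff ((fun g : A⟦X⟧ => ϖ * d⁄dX A g)^[k] (ϖ * PowerSeries.dlog G)) =
      (k.factorial : A) * coeff k (PowerSeries.dlog (Units.map (substAlgHom
        (PowerSeries.HasSubst.of_constantCoeff_zero' (PowerSeries.constantCoeff_substInvOfIsUnit lam hlam1)) :
          A⟦X⟧ →ₐ[A] A⟦X⟧).toMonoidHom G)) := by
  rw [constantCoeff_iterate_derivation_eq_factorial_mul_coeff_subst_substInv hlam0 hlam1 hω,
    dlog_map_substAlgHom_substInv hlam0 hlam1 hω]

end LogCoordinate

/-! ### §2 `λ′ · ω = 1` from the two functional equations (generic) -/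

section LogDifferential

/-- ★ **`λ′ · ω = 1`** whenever `λ ∘ f = C π · λ`, `λ ≡ X (mod deg 2)`, `ω · f′ = C π · ω ∘ f`, `ω(0) = 1`,
`f ≡ πX (mod deg 2)`, `f(0) = 0`, over a ring in which `π` is regular and `1 − πⁿ` (`n ≥ 1`) are units
(e.g. a field with `|π| < 1`): `P = λ′ω` satisfies `P ∘ f · (π f′) = P · (π f′)` and `P(0) = 1`, so `P − 1`
vanishes by `twisted_rigidity` (`φ = id`).  This is the identity "`ω_F = 1/λ′`" behind de Shalit's
`D = (1/λ′) d/dX`. [cite: deShalit1987, Ch. I §3.5 (p. 18), §1.2] [cite: LubinTate1965, §1 Lemma 1] -/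
theorem derivative_log_mul_invDiff_eq_one {π : A} {f lam ϖ : A⟦X⟧}
    (hf0 : constantCoeff f = 0) (hf1 : coeff 1 f = π)
    (hlam1 : coeff 1 lam = 1) (hlamf : lam.subst f = C π * lam)
    (hϖ0 : constantCoeff ϖ = 1) (hEf : ϖ * d⁄dX A f = C π * ϖ.subst f)
    (hreg : ∀ x : A, π * x = 0 → x = 0) (hunit : ∀ n, 1 ≤ n → IsUnit (1 - π ^ n)) :
    d⁄dX A lam * ϖ = 1 := by
  have hs : HasSubst f := HasSubst.of_constantCoeff_zero' hf0
  -- (a) `λ′(f) · f′ = π · λ′`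
  have ha : (d⁄dX A lam).subst f * d⁄dX A f = C π * d⁄dX A lam := by
    rw [← derivative_subst A hs, hlamf, (d⁄dX A).leibniz, derivative_C, smul_zero, add_zero, smul_eq_mul]
  rw [← sub_eq_zero]
  refine twisted_rigidity (RingHom.id A) hf0 hf1 (M₁ := C π * d⁄dX A f) (M₂ := C π * d⁄dX A f) (n₀ := 1)
    (D := d⁄dX A lam * ϖ - 1) (fun k hk => ?_) (fun n hn x hx => ?_) ?_
  · obtain rfl : k = 0 := by omega
    rw [coeff_zero_eq_constantCoeff_apply, map_sub, map_mul, constantCoeff_derivative', hlam1, hϖ0, map_one,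
      mul_one, sub_self]
  · rw [map_mul, constantCoeff_C, constantCoeff_derivative', hf1, RingHom.id_apply] at hx
    have h2 := eq_zero_of_pow_mul_eq_zero_of_regular' hreg 2 (x := (1 - π ^ n) * x) (by linear_combination hx)
    exact (IsUnit.mul_right_eq_zero (hunit n hn)).mp h2
  · have hid : ∀ G : A⟦X⟧, G.map (RingHom.id A) = G := fun G => by ext n; rw [coeff_map, RingHom.id_apply]
    rw [hid, PowerSeries.subst_sub hs, subst_mul' hs, ← coe_substAlgHom hs, map_one, coe_substAlgHom]
    linear_combination (ϖ * d⁄dX A f) * ha - ((d⁄dX A lam).subst f * d⁄dX A f) * hEf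

end LogDifferential

end LubinTate

end Literature.NumberTheory.GaloisRepresentations

end
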